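import Literature.Claims.NS.LiuYong2026
import Literature.Analysis.FluidPDE.ZerothLawProofs
import HarnessLib

/-!
# C138 `LiuYong2026` — `¬ Step2_orbits` (second-lineage kit, refuter-6 g3; KIT POOL, no verdict implied)

The typed ground of «C > 0» (注3.1 p.10 with 定义2.12–2.14 p.8), `Step2_orbits`, is false as typed:
a global Leray–Hopf solution `γ` of the UNFORCED system with `S_N γ = γ` on `t ≥ 0` (`N = n^m ≥ 2`)
satisfies `E(γ(t/N²)) = N² E(γ(t))` for every `t ≥ 0` (Haar invariance of `x ↦ N • x` on `𝕋³`),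
hence `E(γ(t₀/N^{2j})) = N^{2j} E(γ(t₀)) → ∞` at a non-trivial slice `t₀ > 0`, against the energy
inequality `E(γ(s)) ≤ E(γ₀)` for all `s ≥ 0` (zero force). Category G (ground; `_h2` is not consumed
by `claim_of_steps`). Handle (ii) of the skeleton docblock / ref-2 E1.

WHAT THIS IS NOT: not a claim about NS regularity or blow-up; not a claim about any author beyond the
typed locator.
-/

noncomputable section

set_option linter.dupNamespace false

open Set MeasureTheory Filter Topology

namespace Summit.NavierStokesRegularity.NavierStokesRegularity.Theorems.LiuYong2026

open Literature.Claims.NS.LiuYong2026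
open Literature.Analysis Literature.Analysis.FluidPDE Literature.Analysis.FunctionSpaces

/-- Kinetic energy of a rescaled slice: `E(x ↦ N • v(N • x)) = N² E(v)` (Haar invariance of
`x ↦ N • x`, tree `integral_comp_nsmul`). -/
theorem orbit_kineticEnergy_rescale_slice {N : ℕ} (hN : 0 < N) {v : T3 → E3}
    (hv : AEStronglyMeasurable v volume) :
    Torus.kineticEnergy (fun x => (N : ℝ) • v (N • x)) = (N : ℝ) ^ 2 * Torus.kineticEnergy v := by
  unfold Torus.kineticEnergy
  have h1 : ∀ x : T3, ‖(N : ℝ) • v (N • x)‖ ^ 2 = (N : ℝ) ^ 2 * ‖v (N • x)‖ ^ 2 := by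
    intro x
    rw [norm_smul, mul_pow, Real.norm_natCast]
  simp_rw [h1]
  rw [integral_const_mul,
    integral_comp_nsmul hN (g := fun x : T3 => ‖v x‖ ^ 2) (hv.norm.pow 2)]
  ring

/-- A slice that is not a.e. zero and square-integrable has positive kinetic energy. -/
theorem orbit_kineticEnergy_pos_of_not_ae_zero {v : T3 → E3} (hv : MemLp v 2 volume)
    (hnz : ¬ (v =ᵐ[volume] 0)) : 0 < Torus.kineticEnergy v := by
  unfold Torus.kineticEnergy
  have hint : Integrable (fun x => ‖v x‖ ^ 2) volume :=
    (memLp_two_iff_integrable_sq_norm hv.aestronglyMeasurable).1 hv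
  have hnn : 0 ≤ ∫ x, ‖v x‖ ^ 2 := integral_nonneg fun x => by positivity
  rcases hnn.lt_or_eq with hlt | heq
  · positivity
  · exfalso
    apply hnz
    have h0 : (fun x => ‖v x‖ ^ 2) =ᵐ[volume] 0 :=
      (integral_eq_zero_iff_of_nonneg (fun x => by positivity) hint).1 heq.symm
    filter_upwards [h0] with x hx
    have : ‖v x‖ ^ 2 = 0 := hx
    simpa using this

/-- Energy inequality of an unforced global Leray–Hopf solution on `𝕋³`: `E(γ(t)) ≤ E(γ₀)` for
every `t ≥ 0`. -/
theorem orbit_kineticEnergy_le_of_globalLerayHopf_zero {ν : ℝ} (hν : 0 ≤ ν) {γ₀ : T3 → E3}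
    {γ : ℝ → T3 → E3} (h : Torus.IsGlobalLerayHopf ν 0 γ₀ γ) {t : ℝ} (ht : 0 ≤ t) :
    Torus.kineticEnergy (γ t) ≤ Torus.kineticEnergy γ₀ := by
  have hL := h (t + 1) (by linarith)
  have h1 := hL.energy_ineq_zero t ⟨ht, by linarith⟩
  simp only [Pi.zero_apply, inner_zero_left, integral_zero, intervalIntegral.integral_zero,
    add_zero] at h1
  have h2 : 0 ≤ ν * (∫⁻ τ in Ioo 0 t, Torus.eGradNormSq (γ τ)).toReal :=
    mul_nonneg hν ENNReal.toReal_nonneg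
  linarith

/-- **`Step2_orbits` is false as typed**: no unforced global Leray–Hopf solution on `𝕋³` is both
non-trivial at a positive time and fixed by an integer renormalisation `S_N`, `N ≥ 2`, on `t ≥ 0`. -/
theorem not_Step2_orbits : ¬ Step2_orbits := by
  intro h
  obtain ⟨γ, ⟨γ₀, _hγ₀, hLH⟩, ⟨t₀, ht₀, hnz⟩, n, m, hn, hm, hfix⟩ := h 1 one_pos
  -- the scale factor
  have hNge : 2 ≤ n ^ m := by
    calc 2 ≤ n := hn
      _ = n ^ 1 := (pow_one n).symm
      _ ≤ n ^ m := Nat.pow_le_pow_right (by omega) hm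
  have hNpos : 0 < n ^ m := by omega
  set N : ℕ := n ^ m with hNdef
  have hNR : (1 : ℝ) < (N : ℝ) ^ 2 := by
    have : (2 : ℝ) ≤ (N : ℝ) := by exact_mod_cast hNge
    nlinarith
  have hNR0 : (0 : ℝ) < (N : ℝ) ^ 2 := by positivity
  -- slices are a.e.-strongly measurable
  have hmeas : ∀ t : ℝ, 0 ≤ t → AEStronglyMeasurable (γ t) volume := fun t ht =>
    ((hLH (t + 1) (by linarith)).memLp t ⟨ht, by linarith⟩).aestronglyMeasurable
  -- one-step scaling of the energy
  have hS : ∀ t : ℝ, 0 ≤ t →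
      Torus.kineticEnergy (γ (t / (N : ℝ) ^ 2)) = (N : ℝ) ^ 2 * Torus.kineticEnergy (γ t) := by
    intro t ht
    have hfun : γ (t / (N : ℝ) ^ 2) = fun x => (N : ℝ) • γ t (N • x) := by
      funext x
      have hx := hfix (t / (N : ℝ) ^ 2) (by positivity) x
      change (N : ℝ) • γ ((N : ℝ) ^ 2 * (t / (N : ℝ) ^ 2)) (N • x) = γ (t / (N : ℝ) ^ 2) x at hx
      rw [mul_div_cancel₀ t hNR0.ne'] at hx
      exact hx.symm
    rw [hfun, orbit_kineticEnergy_rescale_slice hNpos (hmeas t ht)]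
  -- iterate
  have hiter : ∀ j : ℕ, Torus.kineticEnergy (γ (t₀ / ((N : ℝ) ^ 2) ^ j)) =
      ((N : ℝ) ^ 2) ^ j * Torus.kineticEnergy (γ t₀) := by
    intro j
    induction j with
    | zero => simp
    | succ j ih =>
      have hsplit : t₀ / ((N : ℝ) ^ 2) ^ (j + 1) = (t₀ / ((N : ℝ) ^ 2) ^ j) / (N : ℝ) ^ 2 := by
        rw [pow_succ, div_div]
      rw [hsplit, hS _ (by positivity), ih]
      ring
  -- positivity at the non-trivial slice and the energy ceiling
  have hpos : 0 < Torus.kineticEnergy (γ t₀) :=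
    orbit_kineticEnergy_pos_of_not_ae_zero ((hLH (t₀ + 1) (by linarith)).memLp t₀ ⟨ht₀.le, by linarith⟩) hnz
  obtain ⟨j, hj⟩ := pow_unbounded_of_one_lt
    (Torus.kineticEnergy γ₀ / Torus.kineticEnergy (γ t₀)) hNR
  have hceil := orbit_kineticEnergy_le_of_globalLerayHopf_zero zero_le_one hLH
    (t := t₀ / ((N : ℝ) ^ 2) ^ j) (by positivity)
  rw [hiter j] at hceil
  have hlt : Torus.kineticEnergy γ₀ < ((N : ℝ) ^ 2) ^ j * Torus.kineticEnergy (γ t₀) := by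
    have := (div_lt_iff₀ hpos).1 hj
    linarith
  linarith

/-- Type-exactness probe against the fully-qualified typed token. -/
example : ¬ Literature.Claims.NS.LiuYong2026.Step2_orbits := not_Step2_orbits

end Summit.NavierStokesRegularity.NavierStokesRegularity.Theorems.LiuYong2026

end
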